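import Summits.HodgeConjecture.CorCM.Census.DihedralSexticPair

/-!
# The product `E × B₀ × B₁` of the CM curve of `k` and two Galois-conjugate, non-isogenous simple CM threefolds of a
# NON-Galois sextic CM field `K = k·F₀`: every Galois-balanced weight is a disjoint union of divisor weights and
# quadratic-Weil weights of the sub-products `Bₘ × E`, `B₀ × B₁` — a kernel census

COR-CM (cell `pub-hodgecm2`), seat b30 gen 14 (2026-08-21); count-neutral sequel of `Census/DihedralSexticPair.lean` (the
12-point model `Pt` of `B₀ × B₁`, its `S₃ × C₂`-action `act`, type `phi`, Weil weights `weilPlus`/`weilMinus`).  A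
finite, kernel-decided computation: no named fact, no geometry, no `sorry`.

MODEL.  Points `Pt' = Bool ⊕ Pt`: `inl b` = the embedding of `k` of sign `b` (slot `E`, `true` = the fixed `τ`),
`inr (m, i, b)` = the points of `B₀ × B₁`; `S₃ × C₂` acts on `inl b` through the sign only (`act'`); the CM type
`phi'` is `{τ}` on `E` and `phi` on `B₀ × B₁`.  GENERATING WEIGHTS (`gens`, 7 + 4 + 2 = 13): the conjugate pairs
`{x, c·x}` (divisor classes), the four `k`-Weil weights `weil4 m b = {inl b} ⊔ {inr (m, i, b) : i}` of the Weil-type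
FOURFOLDS `Bₘ × E` (the `±i√d`-eigenlines of `(ι_m(iδ), ι_E(δ))`, Markman), and the two pair weights `pair6 b`
(= `weilPlus`, `weilMinus` of `B₀ × B₁`, the seat's `CorCM/DihedralSexticPairHodgeOfMarkman.lean`).

RESULT (kernel): **every balanced weight of `E × B₀ × B₁`, of any size, is a disjoint union of generating weights**
(`balanced'_decomp`: the min-anchored greedy decomposition `decomp` with fuel `7` succeeds); counts
`1/7/25/49/49/25/7/1 = 164` (`card_balanced'`).  DICTIONARY (formalised downstream, cited here): weight lines of
disjoint unions are cup products of weight lines (`CorCM/CMWeightLinesDisjointUnion.lean`), so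
`B•(E × B₀ × B₁)` is generated by divisors and the quadratic Weil classes of `B₀ × E`, `B₁ × E`, `B₀ × B₁` — all
algebraic modulo Markman's fourfold theorem [cite: Markman2025SurveySecant, Thm. 1.2] [cite: GaoUllmo2025, Thm 3.1]
[cite: Pohlmann1968, Thm 1] [cite: Deligne1982HodgeCycles, §5 (c)].  Contrast: on `B₀ × B₁ × B₂ × E` the face weights
are NOT so generated (`Census/DihedralSexticFace.lean`, `span_certificate`).

## Provenance
Exact python first (seat folder `work/scratch/pairE_census.py`, < 1 s): 164 balanced weights, all decomposable.
-/

namespace Summit.HodgeConjecture.CorCM.Census.DihedralSexticPairCurve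

open Finset
open Summit.HodgeConjecture.CorCM.Census.DihedralSexticPair (Pt act phi weilPlus weilMinus)

/-! ### The model -/

/-- Points of `E × B₀ × B₁`: `inl b` = the embedding of `k` of sign `b`, `inr x` = a point of `B₀ × B₁`.
[cite: GaoUllmo2025, §2.1] -/
abbrev Pt' : Type := Bool ⊕ Pt

/-- The action of `(rʲ sᶠ, cᵈ) ∈ S₃ × C₂`: on the curve slot only the sign moves (by `c`, `d = false`). [folklore] -/
def act' (j : ZMod 3) (f : Bool) (d : Bool) : Pt' → Pt'
  | Sum.inl b => Sum.inl (if d then b else !b)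
  | Sum.inr x => Sum.inr (act j f d x)

/-- Unfolding of `act'` on the curve slot. [folklore] -/
theorem act'_inl (j : ZMod 3) (f d : Bool) (b : Bool) : act' j f d (Sum.inl b) = Sum.inl (if d then b else !b) := rfl

/-- Unfolding of `act'` on the threefold slots. [folklore] -/
theorem act'_inr (j : ZMod 3) (f d : Bool) (x : Pt) : act' j f d (Sum.inr x) = Sum.inr (act j f d x) := rfl

/-- The CM type of `E × B₀ × B₁`: `{τ}` on `E`, `phi` on `B₀ × B₁`. [folklore] -/
def phi' : Finset Pt' := insert (Sum.inl true) (phi.map ⟨Sum.inr, Sum.inr_injective⟩)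

/-- Membership in `phi'`, curve slot. [folklore] -/
theorem mem_phi'_inl (b : Bool) : Sum.inl b ∈ phi' ↔ b = true := by
  cases b <;> decide

/-- Membership in `phi'`, threefold slots. [folklore] -/
theorem mem_phi'_inr (x : Pt) : Sum.inr x ∈ phi' ↔ x ∈ phi := by
  rw [phi', Finset.mem_insert, Finset.mem_map]
  constructor
  · rintro (h | ⟨y, hy, hyx⟩)
    · exact absurd h (by simp)
    · exact (Sum.inr_injective hyx) ▸ hy
  · exact fun h => Or.inr ⟨x, h, rfl⟩

/-- Pohlmann's condition for all twelve `g ∈ S₃ × C₂`. [cite: GaoUllmo2025, Thm 3.1 eq. (3.2)] -/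
def balanced' (S : Finset Pt') : Bool :=
  decide (∀ g : ZMod 3 × Bool × Bool,
    (S.filter fun x => act' g.1 g.2.1 g.2.2 x ∈ phi').card = (S.filter fun x => act' g.1 g.2.1 g.2.2 x ∉ phi').card)

/-! ### The generating weights -/

/-- The conjugate pair `{x, c·x}` (a divisor weight). [cite: Gordon1999HodgeAVSurvey, 9.2.2] -/
def conjPair (x : Pt') : Finset Pt' := {x, act' 0 false false x}

/-- The `k`-Weil weight of the fourfold `Bₘ × E` of sign `b`: the `b`-fibre of slot `m` and the point of `E` of sign `b`
(the `±i√d`-eigenline of `(ι_m(iδ), ι_E(δ))`, Hodge type `(2,2)`). [cite: Deligne1982HodgeCycles, §5 (c)] -/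
def weil4 (m : Fin 2) (b : Bool) : Finset Pt' :=
  {Sum.inl b, Sum.inr (m, 0, b), Sum.inr (m, 1, b), Sum.inr (m, 2, b)}

/-- The pair Weil weights of `B₀ × B₁` (`weilPlus`, `weilMinus` of `Census/DihedralSexticPair.lean`).
[cite: Deligne1982HodgeCycles, §5 (c)] -/
def pair6 (b : Bool) : Finset Pt' := (if b then weilPlus else weilMinus).map ⟨Sum.inr, Sum.inr_injective⟩

/-- The thirteen generating weights. [folklore] -/
def gens : Finset (Finset Pt') :=
  (univ.image conjPair ∪ univ.image fun mb : Fin 2 × Bool => weil4 mb.1 mb.2) ∪ {pair6 true, pair6 false}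

/-- Membership in `gens`, unfolded. [folklore] -/
theorem mem_gens_iff (g : Finset Pt') :
    g ∈ gens ↔ (∃ x, g = conjPair x) ∨ (∃ m b, g = weil4 m b) ∨ g = pair6 true ∨ g = pair6 false := by
  rw [gens, Finset.mem_union, Finset.mem_union, Finset.mem_image, Finset.mem_image, Finset.mem_insert,
    Finset.mem_singleton]
  constructor
  · rintro ((⟨x, -, rfl⟩ | ⟨⟨m, b⟩, -, rfl⟩) | h | h)
    · exact Or.inl ⟨x, rfl⟩
    · exact Or.inr (Or.inl ⟨m, b, rfl⟩)
    · exact Or.inr (Or.inr (Or.inl h))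
    · exact Or.inr (Or.inr (Or.inr h))
  · rintro (⟨x, rfl⟩ | ⟨m, b, rfl⟩ | h | h)
    · exact Or.inl (Or.inl ⟨x, Finset.mem_univ _, rfl⟩)
    · exact Or.inl (Or.inr ⟨(m, b), Finset.mem_univ _, rfl⟩)
    · exact Or.inr (Or.inl h)
    · exact Or.inr (Or.inr h)

/-- Membership in a conjugate pair. [folklore] -/
theorem mem_conjPair_iff (x y : Pt') : y ∈ conjPair x ↔ y = x ∨ y = act' 0 false false x := by
  rw [conjPair, Finset.mem_insert, Finset.mem_singleton]

/-- Membership in `weil4 m b`. [folklore] -/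
theorem mem_weil4_iff (m : Fin 2) (b : Bool) (y : Pt') :
    y ∈ weil4 m b ↔ y = Sum.inl b ∨ ∃ i : ZMod 3, y = Sum.inr (m, i, b) := by
  rw [weil4]
  simp only [Finset.mem_insert, Finset.mem_singleton]
  constructor
  · rintro (h | h | h | h)
    · exact Or.inl h
    · exact Or.inr ⟨0, h⟩
    · exact Or.inr ⟨1, h⟩
    · exact Or.inr ⟨2, h⟩
  · rintro (h | ⟨i, h⟩)
    · exact Or.inl h
    · fin_cases i
      · exact Or.inr (Or.inl h)
      · exact Or.inr (Or.inr (Or.inl h))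
      · exact Or.inr (Or.inr (Or.inr h))

/-- Membership in `pair6 b`. [folklore] -/
theorem mem_pair6_iff (b : Bool) (y : Pt') :
    y ∈ pair6 b ↔ ∃ x : Pt, y = Sum.inr x ∧ x ∈ (if b then weilPlus else weilMinus) := by
  rw [pair6, Finset.mem_map]
  constructor
  · rintro ⟨x, hx, rfl⟩; exact ⟨x, rfl, hx⟩
  · rintro ⟨x, rfl, hx⟩; exact ⟨x, hx, rfl⟩

/-! ### The min-anchored greedy decomposition -/

/-- An injective rank on the points (to anchor the decomposition at the minimal point). [folklore] -/
def rk : Pt' → ℕ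
  | Sum.inl b => if b then 1 else 0
  | Sum.inr (m, i, b) => 2 + (m.val * 6 + i.val * 2 + (if b then 1 else 0))

/-- `x` is a point of `S` of minimal rank. [folklore] -/
def isMin (S : Finset Pt') (x : Pt') : Bool := decide (x ∈ S ∧ ∀ y ∈ S, rk x ≤ rk y)

/-- **Greedy decomposition with fuel `n`**: `S` is empty, or some generating weight `g ⊆ S` contains the minimal point
of `S` and `S ∖ g` decomposes with fuel `n - 1`. [folklore] -/
def decomp : ℕ → Finset Pt' → Bool
  | 0, S => decide (S = ∅)
  | n + 1, S => decide (S = ∅) ||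
      decide (∃ g ∈ gens, (∃ x ∈ g, isMin S x = true) ∧ g ⊆ S ∧ decomp n (S \ g) = true)

/-- Unfolding of `decomp` at fuel `0`. [folklore] -/
theorem decomp_zero (S : Finset Pt') : decomp 0 S = true ↔ S = ∅ := by
  rw [decomp, decide_eq_true_eq]

/-- Unfolding of `decomp` at positive fuel (the anchoring clause may be forgotten by consumers). [folklore] -/
theorem decomp_succ (n : ℕ) (S : Finset Pt') :
    decomp (n + 1) S = true → S = ∅ ∨ ∃ g ∈ gens, g ⊆ S ∧ decomp n (S \ g) = true := by
  rw [decomp, Bool.or_eq_true, decide_eq_true_eq, decide_eq_true_eq]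
  rintro (h | ⟨g, hg, -, hgS, hdec⟩)
  · exact Or.inl h
  · exact Or.inr ⟨g, hg, hgS, hdec⟩

/-! ### Sanity of the model -/

set_option maxRecDepth 8000 in
/-- `phi'` is a CM type (exactly one of `x`, `c·x`), and `c = act' 0 false false` is a fixed-point-free involution.
[folklore] -/
theorem isCMType_phi' : (∀ x : Pt', (x ∈ phi' ↔ act' 0 false false x ∉ phi')) ∧
    (∀ x : Pt', act' 0 false false (act' 0 false false x) = x) ∧ (∀ x : Pt', act' 0 false false x ≠ x) := by
  refine ⟨by decide +kernel, by decide +kernel, by decide +kernel⟩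

set_option maxRecDepth 32000 in
set_option maxHeartbeats 4000000 in
/-- The generating weights are balanced: the conjugate pairs, the `weil4 m b` (four points, two in the type: Hodge
type `(2,2)` on the fourfold `Bₘ × E`) and the `pair6 b` (six points, three in the type). [cite: Deligne1982HodgeCycles, §5 (c)] -/
theorem gens_balanced : (∀ x : Pt', balanced' (conjPair x) = true) ∧
    (∀ m : Fin 2, ∀ b : Bool, balanced' (weil4 m b) = true ∧ (weil4 m b).card = 4 ∧
      ((weil4 m b).filter fun x => x ∈ phi').card = 2) ∧
    (∀ b : Bool, balanced' (pair6 b) = true ∧ (pair6 b).card = 6 ∧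
      ((pair6 b).filter fun x => x ∈ phi').card = 3) := by
  refine ⟨by decide +kernel, by decide +kernel, by decide +kernel⟩

/-! ### The census -/

set_option maxRecDepth 32000 in
set_option maxHeartbeats 8000000 in
/-- **Every Galois-balanced weight of `E × B₀ × B₁` is a disjoint union of generating weights** (conjugate pairs,
`k`-Weil weights of `Bₘ × E`, pair Weil weights of `B₀ × B₁`): the greedy decomposition succeeds with fuel `7`.
[cite: GaoUllmo2025, Thm 3.1] [cite: Deligne1982HodgeCycles, §5 (c)] [cite: Markman2025SurveySecant, Thm. 1.2] -/
theorem balanced'_decomp : ∀ S : Finset Pt', balanced' S = true → decomp 7 S = true := by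
  decide +kernel

set_option maxRecDepth 32000 in
set_option maxHeartbeats 8000000 in
/-- **The census**: `164 = 1+7+25+49+49+25+7+1` balanced weights (sizes `0, 2, …, 14`);
`dim B²(E × B₀ × B₁) = 25 = 21` divisor monomials `+ 4` Weil lines of the `Bₘ × E`.
[cite: GaoUllmo2025, Thm 3.1] -/
theorem card_balanced' : ((univ : Finset (Finset Pt')).filter fun S => balanced' S = true).card = 164 ∧
    (((univ : Finset Pt').powersetCard 4).filter fun S => balanced' S = true).card = 25 ∧
    (((univ : Finset Pt').powersetCard 6).filter fun S => balanced' S = true).card = 49 := by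
  refine ⟨by decide +kernel, by decide +kernel, by decide +kernel⟩

end Summit.HodgeConjecture.CorCM.Census.DihedralSexticPairCurve
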